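import Summits.BirchSwinnertonDyer.BirchSwinnertonDyer.Theorems.GenusKolyvaginAtTwoK1PosSuHalvesSwappedLedgerDepth
import HarnessLib

/-!
# Route `GenusKolyvaginAtTwo`, crux K₁⁻ `K1Neg` (stmt-BirchSwinnertonDyer-31525), LINE 30 «su_halves»: THE REPAIRED RANK-ONE HALF ON `Δ < 0` —
# a DEPTH-ONE auxiliary frame (`4 ∤ y_(K')`, certified by a Kriz–Li-type `2`-adic logarithm bound) + the landed swapped ledger + rank-zero
# `2`-integrality ⟹ `ord₂ #Ш_an(Wd) ≤ 0`

Seat `bsd-line-gk2-p3` g32 (PROVER seat 3/3, cell `bsd-f1-sign2`), `--supports stmt-BirchSwinnertonDyer-31525` (helper; closes nothing); sequel of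
`…K1NegSuHalvesStarFrameObstruction` (p781564: on K₁⁻ the depth-ZERO (★)-frame of LINE 30's B1′ is refuted modulo the leaf) and `…SwappedLedger{,Depth}`
(p781983/p782144: the exact swapped ledger; B2 at depth).  THEOREMS ONLY (no definition, no named fact, no `sorry`); standard axioms.  **BSD is NOT
proved by this file; K1Neg is NOT proved; no item is closed.**  §3 is CONDITIONAL (D-0014) on the route's four STATEMENT-ONLY published facts and on two
DISPLAYED hypotheses of conjecture/print grade (a depth-one frame supply B1⁻ and the rank-zero `2`-integrality B3♯) — a reshaped-line certificate for the
pen, not progress on BSD.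

THE REPAIR.  On a K₁⁻ frame the twin `Wd` (rank `1`, `#Sel₂ = 2`) has `ord₂ C(Wd) = 1`, so (Gross's formula) its Heegner points over auxiliary fields are
`2`-divisible and the right witness is DEPTH ONE: `4 ∤ y_(K')`.  With the landed ledger at depth (`SwappedLedger.swappedLedger_le_of_index_le`:
`ord₂ [Wd(K'):ℤy_(K')] ≤ ord₂ c' + ord₂ C(Wd)` ⟹ `ord₂ #Ш_an(Wd) + ord₂ #Ш_an(W') ≤ 0`) this gives the rank-one half B from: B1⁻ (a depth-one frame),
B3♯ (`0 ≤ ord₂ #Ш_an(W')` for the rank-`0` partner).  And depth one has a Kriz–Li-STYLE CERTIFICATE: the printed Lemma 5.4 argument one level up.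

* §1 `not_exists_two_pow_nsmul_add_torsion_of_norm_padicLogPoint` — Kriz–Li's Lemma 5.4 argument at level `2^k` (UNCONDITIONAL): for `W/ℚ` globally
  minimal, `P ∈ E(K)`, `j : K → ℚ₂`, `m = c₂·|Ẽ^{ns}(𝔽₂)|`: if `‖log_W(m • P₂)‖ > 2^{-(k+1)}` then `P ≠ 2^k • Q + T` for all `Q` and torsion `T`
  (`log(m•(2^k Q + T)) = 2^k log(m•Q)` has norm `≤ 2^{-k}·2^{-1}`).  At `k = 1` this is the tree's `not_exists_two_nsmul_add_torsion_of_assumptionStar`;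
  `not_exists_four_zsmul_eq_of_depthOneCertificate` — the `k = 2` instance in (★)-currency: **(★₁) `‖log_W(m • P₂)/(c₂·c_E)‖ = 2⁻²`** with `c₂`, `c_E` odd
  ⟹ `P ∉ 4·E(K)` and `P` of infinite order.
* §2 `exists_two_pow_zsmul_eq_of_le_padicValNat_index` — in a rank-one `E(K)` without `2`-torsion, `k ≤ ord₂ [E(K):ℤP]` ⟹ `P ∈ 2^k E(K)`; so `P ∉ 4E(K)`
  ⟹ `ord₂ [E(K):ℤP] ≤ 1`.
* §3 **`K1Neg.rankOneHalf_of_depthOneFrame`** — ON A K₁⁻ FRAME (`W` globally minimal, `Δ_W < 0`; `K` odd-`d_K` Heegner; `Wd` a globally minimal twin with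
  `r_an(Wd) = 1`, `#Sel₂(Wd) = 2`): an auxiliary frame `K'` of `Wd` (odd `d_(K') ≠ −3`, Heegner for `N(Wd)`, odd-Manin `Dt'`, `P' ∈ Wd(K')` under `P(1)`) with
  **`P' ∉ 4·Wd(K')`**, a globally minimal partner `W' ≅ Wd^(d_K')` with `#Ш_an(W') = q'` and **`0 ≤ ord₂ q'`**, and the four PRINT facts ⟹
  **`ord₂ #Ш_an(Wd) ≤ 0`** (= LINE 30's `stub_rankOneHalf`/B conclusion).  `K1Neg.rankOneHalf_of_depthOneCertificate` — the same with `P' ∉ 4·Wd(K')`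
  replaced by the certificate (★₁) and `c₂(Wd)` odd.  So a v1.4 of LINE 30 can read: B ⟸ B1⁻ «depth-one (★₁)-frame supply for the K₁⁻ twin» (beyond
  print, per-pair computable certificate) + B3♯ «rank-zero `2`-integrality of `#Ш_an`» (print-type) — B2 is no longer a stub.

HONEST FRAMING: bookkeeping over landed theorems; B1⁻/B3♯ are displayed hypotheses; nothing about BSD is proved; no frame is shown to satisfy (★₁).
References: [KrizLi2019] FMS Lemma 5.4 (proof), Thm. 1.12; [GrossZagier1986] V.§2 (2.2)–(2.3); [Milne1972ArithmeticAV] §1 Thm. 1; [SilvermanAEC2009]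
IV.6.4, VII.2.1–2.2; [Miller2011LMS] Def. 1.1.
-/

set_option autoImplicit false
set_option linter.dupNamespace false -- `Summit.<P>.<Sub>` repeats `BirchSwinnertonDyer` (D-0017)

noncomputable section

open scoped Classical

open WeierstrassCurve NumberField Literature.NumberTheory.EllipticCurves Literature.NumberTheory.EllipticCurves.ModularForms
  Literature.NumberTheory.EllipticCurves.Rank1Residual Literature.NumberTheory.EllipticCurves.Rank1Residual.Typed
  Literature.NumberTheory.EllipticCurves.KrizLi2019
  Summit.BirchSwinnertonDyer.Rank1Residual Summit.BirchSwinnertonDyer.Rank1Residual.AdditivePotMult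
  Summit.BirchSwinnertonDyer.BirchSwinnertonDyer.Rank1Residual Summit.BirchSwinnertonDyer.BirchSwinnertonDyer.Theses.GenusKolyvaginAtTwo
  Summit.BirchSwinnertonDyer.BirchSwinnertonDyer.Theorems.CMExactDescent Summit.BirchSwinnertonDyer.BirchSwinnertonDyer.Theorems.GenusExact.TwinSwap

namespace Summit.BirchSwinnertonDyer.BirchSwinnertonDyer.Theorems.GenusExact.SuHalves.DepthOne

/-! ## §1 Kriz–Li's Lemma 5.4 argument at level `2^k`: a logarithm bound certifies `P ∉ 2^k E(K) + E(K)_tors` -/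

/-- **Logarithm certificate at level `2^k` (Kriz–Li Lemma 5.4, one level up; UNCONDITIONAL).**  `W/ℚ` globally minimal, `K` a number field,
`P ∈ E(K)`, `j : K → ℚ₂`, `m = c₂(E)·|Ẽ^{ns}(𝔽₂)|` (so `m • X ∈ E₁(ℚ₂)` for every `X`): if `2^{-(k+1)} < ‖log_W(m • P₂)‖` then there are NO `Q, T ∈ E(K)`
with `T` torsion and `P = 2^k • Q + T` — since `log(m • (2^k Q + T)) = 2^k · log(m • Q)` has norm `≤ 2^{-k} · 2^{-1}`.
[cite: KrizLi2019, Lemma 5.4 (FMS p. 32; = arXiv:1606.03172 Lemma 4.1), proof] [cite: SilvermanAEC2009, IV.6.4 and VII.2.2] -/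
theorem not_exists_two_pow_nsmul_add_torsion_of_norm_padicLogPoint
    (W : WeierstrassCurve ℚ) [W.IsElliptic] [W.IsGloballyMinimal] (K : Type) [Field K] [NumberField K]
    (P : (W.baseChange K).toAffine.Point) (j : K →ₐ[ℚ] ℚ_[2]) (k : ℕ)
    (hnorm : haveI : Fact (Nat.Prime 2) := ⟨Nat.prime_two⟩;
      ((2 : ℝ)⁻¹) ^ (k + 1) < ‖(W.baseChange ℚ_[2]).padicLogPoint
        ((((W.baseChange ℚ_[2]).localTamagawaNumber ℤ_[2]) * nsPointCountAtTwo W) • WeierstrassCurve.Affine.Point.map j P)‖) :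
    ¬ ∃ Q T : (W.baseChange K).toAffine.Point, IsOfFinAddOrder T ∧ P = (2 ^ k) • Q + T := by
  haveI : Fact (Nat.Prime 2) := ⟨Nat.prime_two⟩
  haveI : (W.baseChange ℚ_[2]).IsMinimal ℤ_[2] := isMinimal_map_padic_of_isGloballyMinimal W 2
  rintro ⟨Q, T, hT, rfl⟩
  set E₂ := W.baseChange ℚ_[2] with hE₂
  set m : ℕ := (W.baseChange ℚ_[2]).localTamagawaNumber ℤ_[2] * nsPointCountAtTwo W with hm
  set f := WeierstrassCurve.Affine.Point.map (W' := W) j with hf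
  have hQ₁ : E₂.IsInReductionKernel (m • f Q) := isInReductionKernel_tamagawa_mul_nsPointCountAtTwo_nsmul W (f Q)
  have hT₁ : E₂.IsInReductionKernel (m • f T) := isInReductionKernel_tamagawa_mul_nsPointCountAtTwo_nsmul W (f T)
  have hmap : m • f ((2 ^ k) • Q + T) = (2 ^ k) • (m • f Q) + m • f T := by
    rw [map_add, map_nsmul, nsmul_add, smul_smul, smul_smul, mul_comm]
  obtain ⟨hkQ₁, hlogkQ⟩ := AcPConverseLinks.padicLogPoint_nsmul W 2 (m • f Q) hQ₁ (2 ^ k)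
  have hadd := padicLogPoint_add_holds 2 E₂ ((2 ^ k) • (m • f Q)) (m • f T) hkQ₁ hT₁
  have hTfin : IsOfFinAddOrder (m • f T) := (f.isOfFinAddOrder hT).nsmul
  have hTlog : E₂.padicLogPoint (m • f T) = 0 :=
    padicLogPoint_eq_zero_of_isOfFinAddOrder_of_isInReductionKernel W 2 hT₁ hTfin
  have hval : E₂.padicLogPoint (m • f ((2 ^ k) • Q + T)) = ((2 ^ k : ℕ) : ℚ_[2]) * E₂.padicLogPoint (m • f Q) := by
    rw [hmap, hadd.2, hlogkQ, hTlog, add_zero]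
  have h2norm : ‖((2 ^ k : ℕ) : ℚ_[2])‖ = ((2 : ℝ)⁻¹) ^ k := by
    rw [Nat.cast_pow, Nat.cast_ofNat, norm_pow]
    congr 1
    exact_mod_cast Padic.norm_p (p := 2)
  have hQlog : ‖E₂.padicLogPoint (m • f Q)‖ ≤ 2⁻¹ := by
    have h := E₂.norm_padicLogPoint_le_of_isInReductionKernel hQ₁
    exact_mod_cast h
  have hbound : ‖E₂.padicLogPoint (m • f ((2 ^ k) • Q + T))‖ ≤ ((2 : ℝ)⁻¹) ^ k * 2⁻¹ := by
    rw [hval, norm_mul, h2norm]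
    gcongr
  have : ((2 : ℝ)⁻¹) ^ (k + 1) = ((2 : ℝ)⁻¹) ^ k * 2⁻¹ := pow_succ _ _
  linarith

/-- **(★₁) — the DEPTH-ONE certificate in (★)-currency: `‖log_W(m • P₂)/(c₂·c_E)‖ = 2⁻²` with `c₂(E)`, `c_E` odd ⟹ `P ∉ 4·E(K)` and `P` has infinite
order** (level `k = 2` of `not_exists_two_pow_nsmul_add_torsion_of_norm_padicLogPoint`; a torsion `P` is `4 • O + P`).  UNCONDITIONAL; no frame is
shown to satisfy (★₁).  [cite: KrizLi2019, Lemma 5.4 (FMS), proof] -/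
theorem not_exists_four_zsmul_eq_of_depthOneCertificate
    (W : WeierstrassCurve ℚ) [W.IsElliptic] [W.IsGloballyMinimal] {N : ℕ} [NeZero N] (Dt : ModularParametrizationData W N)
    (K : Type) [Field K] [NumberField K] (P : (W.baseChange K).toAffine.Point) (j : K →ₐ[ℚ] ℚ_[2])
    (hstar1 : haveI : Fact (Nat.Prime 2) := ⟨Nat.prime_two⟩;
      ‖(W.baseChange ℚ_[2]).padicLogPoint ((((W.baseChange ℚ_[2]).localTamagawaNumber ℤ_[2]) * nsPointCountAtTwo W) •
          WeierstrassCurve.Affine.Point.map j P) / ((((W.baseChange ℚ_[2]).localTamagawaNumber ℤ_[2] : ℕ) : ℚ_[2]) * (Dt.c : ℚ_[2]))‖ = 2⁻¹ * 2⁻¹)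
    (hc2 : haveI : Fact (Nat.Prime 2) := ⟨Nat.prime_two⟩; Odd ((W.baseChange ℚ_[2]).localTamagawaNumber ℤ_[2])) (hc : Odd Dt.c) :
    (¬ ∃ Q : (W.baseChange K).toAffine.Point, (4 : ℤ) • Q = P) ∧ ¬ IsOfFinAddOrder P := by
  haveI : Fact (Nat.Prime 2) := ⟨Nat.prime_two⟩
  have hc2n : ‖(((W.baseChange ℚ_[2]).localTamagawaNumber ℤ_[2] : ℕ) : ℚ_[2])‖ = 1 :=
    Padic.norm_natCast_eq_one_iff.mpr (Nat.coprime_two_left.mpr hc2)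
  have hcn : ‖((Dt.c : ℤ) : ℚ_[2])‖ = 1 := by
    refine le_antisymm (Padic.norm_int_le_one _) (not_lt.mp fun hlt => ?_)
    rw [Padic.norm_intCast_lt_one_iff] at hlt
    exact Int.not_even_iff_odd.mpr hc (even_iff_two_dvd.mpr (by exact_mod_cast hlt))
  rw [norm_div, norm_mul, hc2n, hcn, mul_one, div_one] at hstar1
  have hnorm : ((2 : ℝ)⁻¹) ^ (2 + 1) < ‖(W.baseChange ℚ_[2]).padicLogPoint
      ((((W.baseChange ℚ_[2]).localTamagawaNumber ℤ_[2]) * nsPointCountAtTwo W) • WeierstrassCurve.Affine.Point.map j P)‖ := by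
    rw [hstar1]; norm_num
  have h := not_exists_two_pow_nsmul_add_torsion_of_norm_padicLogPoint W K P j 2 hnorm
  refine ⟨fun ⟨Q, hQ⟩ ↦ h ⟨Q, 0, IsOfFinAddOrder.zero, ?_⟩, fun hP ↦ h ⟨0, P, hP, by simp⟩⟩
  rw [add_zero, ← hQ, show (4 : ℤ) = ((2 ^ 2 : ℕ) : ℤ) by norm_num, natCast_zsmul]

/-! ## §2 In a rank-one group without `2`-torsion: `k ≤ ord₂ [E(K):ℤP]` ⟹ `P ∈ 2^k E(K)` -/

/-- **`k ≤ ord₂ [A : ℤP₀]` makes `P₀` `2^k`-divisible** in a rank-one Mordell–Weil group without `2`-torsion (rank-one coordinate; the odd torsion is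
`2^k`-divisible).  [folklore] -/
theorem exists_two_pow_zsmul_eq_of_le_padicValNat_index {F : Type} [Field F] [NumberField F] (V : WeierstrassCurve F) [V.IsElliptic]
    (hrk : V.mordellWeilRank = 1) (hiv : ∀ x : V.toAffine.Point, 2 • x = 0 → x = 0)
    (P₀ : V.toAffine.Point) (hPinf : ¬ IsOfFinAddOrder P₀) (k : ℕ) (hI : k ≤ padicValNat 2 (AddSubgroup.zmultiples P₀).index) :
    ∃ R : V.toAffine.Point, ((2 ^ k : ℕ) : ℤ) • R = P₀ := by
  haveI : Fact (Nat.Prime 2) := ⟨Nat.prime_two⟩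
  haveI : Finite (AddCommGroup.torsion V.toAffine.Point) := WeierstrassCurve.finite_torsion_point (W := V)
  obtain ⟨c, Q, hcQ, hcker⟩ := X11b.RankOne.exists_coord_of_mordellWeilRank_eq_one V hrk
  have hcP : c P₀ ≠ 0 := fun h0 ↦ hPinf (hcker P₀ h0)
  rw [X11b.RankOne.padicValNat_index_zmultiples_eq c Q hcQ hcker hiv P₀ hcP] at hI
  have h2c : 2 ^ k ∣ (c P₀).natAbs := (padicValNat_dvd_iff_le (Int.natAbs_ne_zero.mpr hcP)).mpr hI
  obtain ⟨a, ha⟩ := Int.ofNat_dvd_left.mpr h2c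
  have ht : IsOfFinAddOrder (P₀ - c P₀ • Q) := X11b.RankOne.isOfFinAddOrder_sub_coord_zsmul c Q hcQ hcker P₀
  obtain ⟨t', ht'⟩ := X11b.LocalIndex.mem_range_nsmul_pow_of_isOfFinAddOrder hiv k ht
  have ht'' : (2 ^ k) • t' = P₀ - c P₀ • Q := by rw [← nsmulAddMonoidHom_apply]; exact ht'
  refine ⟨a • Q + t', ?_⟩
  rw [smul_add, smul_smul, ← ha, natCast_zsmul, ht'']
  abel

/-- **`P₀ ∉ 4E(K)` ⟹ `ord₂ [E(K):ℤP₀] ≤ 1`** (rank one, no `2`-torsion). [folklore] -/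
theorem padicValNat_index_le_one_of_not_four_zsmul {F : Type} [Field F] [NumberField F] (V : WeierstrassCurve F) [V.IsElliptic]
    (hrk : V.mordellWeilRank = 1) (hiv : ∀ x : V.toAffine.Point, 2 • x = 0 → x = 0)
    (P₀ : V.toAffine.Point) (hPinf : ¬ IsOfFinAddOrder P₀) (h4 : ¬ ∃ Q : V.toAffine.Point, (4 : ℤ) • Q = P₀) :
    padicValNat 2 (AddSubgroup.zmultiples P₀).index ≤ 1 := by
  by_contra hlt
  obtain ⟨R, hR⟩ := exists_two_pow_zsmul_eq_of_le_padicValNat_index V hrk hiv P₀ hPinf 2 (by omega)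
  exact h4 ⟨R, by simpa using hR⟩

/-! ## §3 The repaired rank-one half on a K₁⁻ frame: depth-one auxiliary frame + swapped ledger + rank-zero integrality -/

/-- **LINE 30 REPAIRED: the rank-one half B of K₁⁻ from a DEPTH-ONE auxiliary frame.**  K₁⁻ frame data: `W/ℚ` globally minimal with `Δ_W < 0`; `K`
imaginary quadratic with odd `d_K`, Heegner for `N_W`; `Wd` a globally minimal model of `W^(d_K)` with `r_an(Wd) = 1` and `#Sel₂(Wd) = 2` (so
`2 ∣ C(Wd)`).  Auxiliary frame: `K'` imaginary quadratic with odd `d_(K') ≠ −3`, Heegner for `N(Wd)`; an odd-Manin datum `Dt'` of `Wd`; `d₁'`; `P' ∈ Wd(K')`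
under `P(1)` with **`P' ∉ 4·Wd(K')`** (B1⁻'s witness); a globally minimal `W' ≅ Wd^(d_K')` with `#Ш_an(W') = q'` and **`0 ≤ ord₂ q'`** (B3♯).  Then, modulo
the four PRINT facts, **`#Ш_an(Wd) = qd` with `ord₂ qd ≤ 0`** — LINE 30's `stub_rankOneHalf` conclusion for this `Wd`.  (`P'` has infinite order since the
odd torsion is `4`-divisible; `ord₂ I' ≤ 1 ≤ ord₂ c' + ord₂ C(Wd)`; `SwappedLedger.swappedLedger_le_of_index_le`.)  CONDITIONAL on the displayed
hypotheses; nothing about BSD is proved; no depth-one frame is exhibited.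
[cite: GrossZagier1986, V.§2 (2.2)–(2.3)] [cite: Milne1972ArithmeticAV, §1 Thm. 1] [cite: Kramer1981, proof of Thm. 2] [cite: SilvermanATAEC1994, IV.9.4 Step 6] -/
theorem K1Neg.rankOneHalf_of_depthOneFrame
    (hGZ : GrossZagierAllLevels) (hL : EntireLFunctionRat) (hGZK : MultPublishedInputsAtTwo) (hMi : MilneAnyModel)
    (W : WeierstrassCurve ℚ) [W.IsElliptic] [W.IsGloballyMinimal] (hneg : W.Δ < 0)
    (K : Type) [Field K] [NumberField K] (hIQ : IsImaginaryQuadratic K) (hodd : Odd (NumberField.discr K))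
    (hHe : SatisfiesHeegnerHypothesis (W.conductorNorm ℤ) K)
    (Wd : WeierstrassCurve ℚ) [Wd.IsElliptic] [Wd.IsGloballyMinimal] [NeZero (Wd.conductorNorm ℤ)]
    (hWd : ∃ C : VariableChange ℚ, C • W.quadraticTwist (NumberField.discr K : ℚ) = Wd)
    (hrd : Wd.analyticRank = 1) (hSel : Nat.card (Wd.selmerGroup 2) = 2)
    (K' : Type) [Field K'] [NumberField K'] (hIQ' : IsImaginaryQuadratic K') (hodd' : Odd (NumberField.discr K')) (h3' : NumberField.discr K' ≠ -3)
    (hHe' : SatisfiesHeegnerHypothesis (Wd.conductorNorm ℤ) K')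
    (Dt' : ModularParametrizationData Wd (Wd.conductorNorm ℤ)) (hc' : Odd Dt'.c)
    (β' : ℤ) (ι' : K' →+* ℂ) (d₁' : KolyvaginHeegnerData Dt' β' ι' 1)
    (P' : (Wd.baseChange K').toAffine.Point)
    (hP' : WeierstrassCurve.Affine.Point.map (W' := Wd) (algebraMap K' (ringClassField K' ι' 1)).toRatAlgHom P' = d₁'.derivedPoint)
    (h4 : ¬ ∃ Q : (Wd.baseChange K').toAffine.Point, (4 : ℤ) • Q = P')
    (W' : WeierstrassCurve ℚ) [W'.IsElliptic] [W'.IsGloballyMinimal]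
    (hW' : ∃ C : VariableChange ℚ, C • Wd.quadraticTwist (NumberField.discr K' : ℚ) = W')
    (q' : ℚ) (hq' : shaAn W' = (q' : ℂ)) (hB3 : 0 ≤ padicValRat 2 q') :
    ∃ qd : ℚ, shaAn Wd = (qd : ℂ) ∧ padicValRat 2 qd ≤ 0 := by
  haveI : Fact (Nat.Prime 2) := ⟨Nat.prime_two⟩
  haveI hEK : (Wd.baseChange K').IsElliptic := isElliptic_baseChange' Wd K'
  have hc0 : Dt'.c ≠ 0 := by
    obtain ⟨k, hk⟩ := hc'
    omega
  -- the K₁⁻ twin has `2 ∣ C(Wd)`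
  obtain ⟨h2T, -⟩ := StarObstruction.K1Neg.two_dvd_tamagawaProduct_twin W hneg hIQ hodd hHe Wd hWd
  have hC1 : 1 ≤ padicValNat 2 Wd.tamagawaProduct := one_le_padicValNat_of_dvd Wd.tamagawaProduct_pos_holds.ne' h2T
  -- no `2`-torsion over `K'` (rank `Wd(ℚ) = 1` by GZK and `#Sel₂ = 2`), so `P'` has infinite order
  obtain ⟨hrankD, -⟩ := hGZK Wd (by rw [hrd])
  have hrk : 1 ≤ Wd.mordellWeilRank := by rw [hrankD, hrd]
  obtain ⟨-, hT2, -⟩ := rank_eq_one_and_sha_primary_eq_zero_of_natCard_selmerGroup_eq_two Wd hSel hrk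
  have hT2' : ∀ P : Wd.toAffine.Point, 2 • P = 0 → P = 0 := fun P hP ↦ by convert hT2 P (by convert hP)
  have hiv : ∀ x : (Wd.baseChange K').toAffine.Point, 2 • x = 0 → x = 0 := fun x hx ↦
    forall_two_zsmul_baseChange_eq_zero_of_heegner Wd K' hIQ' hodd' hHe' hT2' x (by rw [← natCast_zsmul] at hx; exact_mod_cast hx)
  have hPinf : ¬ IsOfFinAddOrder P' := by
    intro hfin
    obtain ⟨t', ht'⟩ := X11b.LocalIndex.mem_range_nsmul_pow_of_isOfFinAddOrder hiv 2 hfin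
    rw [nsmulAddMonoidHom_apply] at ht'
    exact h4 ⟨t', by rw [show (4 : ℤ) = ((2 ^ 2 : ℕ) : ℤ) by norm_num, natCast_zsmul, ht']⟩
  -- rank `Wd(K') = 1` (Gross–Zagier) and `ord₂ I' ≤ 1`
  obtain ⟨-, -, -, hrkK, -, -, -, -⟩ := SwappedLedger.swappedLedger Wd K' (hGZ _ Wd K') hGZK hL hMi hrd hSel hIQ' hodd' h3' hHe' Dt' hc0 β'
    ι' d₁' P' hP' hPinf W' hW' q' hq'
  have hI1 := padicValNat_index_le_one_of_not_four_zsmul (Wd.baseChange K') hrkK hiv P' hPinf h4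
  have hvc : padicValInt 2 Dt'.c = 0 :=
    padicValInt.eq_zero_of_not_dvd (fun h2c ↦ (Int.not_even_iff_odd.mpr hc') (even_iff_two_dvd.mpr h2c))
  have hI : (padicValNat 2 (AddSubgroup.zmultiples P').index : ℤ) ≤ padicValInt 2 Dt'.c + padicValNat 2 Wd.tamagawaProduct := by
    rw [hvc]
    have h := hI1.trans hC1
    have h' : ((padicValNat 2 (AddSubgroup.zmultiples P').index : ℕ) : ℤ) ≤ (padicValNat 2 Wd.tamagawaProduct : ℤ) := by exact_mod_cast h
    simpa using h'
  obtain ⟨qd, hqd, hle⟩ := SwappedLedger.swappedLedger_le_of_index_le Wd K' (hGZ _ Wd K') hGZK hL hMi hrd hSel hIQ' hodd' h3' hHe' Dt' hc0 β'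
    ι' d₁' P' hP' hPinf hI W' hW' q' hq'
  exact ⟨qd, hqd, by linarith⟩

/-- **The same from the (★₁) certificate** (`‖log_(Wd)(m • P'₂)/(c₂·c')‖ = 2⁻²`, `c₂(Wd)` odd) instead of `P' ∉ 4·Wd(K')`.  CONDITIONAL on the displayed
hypotheses; nothing about BSD is proved; no frame is shown to satisfy (★₁). [cite: KrizLi2019, Lemma 5.4 (FMS), proof] [cite: GrossZagier1986, V.§2 (2.2)] -/
theorem K1Neg.rankOneHalf_of_depthOneCertificate
    (hGZ : GrossZagierAllLevels) (hL : EntireLFunctionRat) (hGZK : MultPublishedInputsAtTwo) (hMi : MilneAnyModel)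
    (W : WeierstrassCurve ℚ) [W.IsElliptic] [W.IsGloballyMinimal] (hneg : W.Δ < 0)
    (K : Type) [Field K] [NumberField K] (hIQ : IsImaginaryQuadratic K) (hodd : Odd (NumberField.discr K))
    (hHe : SatisfiesHeegnerHypothesis (W.conductorNorm ℤ) K)
    (Wd : WeierstrassCurve ℚ) [Wd.IsElliptic] [Wd.IsGloballyMinimal] [NeZero (Wd.conductorNorm ℤ)]
    (hWd : ∃ C : VariableChange ℚ, C • W.quadraticTwist (NumberField.discr K : ℚ) = Wd)
    (hrd : Wd.analyticRank = 1) (hSel : Nat.card (Wd.selmerGroup 2) = 2)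
    (K' : Type) [Field K'] [NumberField K'] (hIQ' : IsImaginaryQuadratic K') (hodd' : Odd (NumberField.discr K')) (h3' : NumberField.discr K' ≠ -3)
    (hHe' : SatisfiesHeegnerHypothesis (Wd.conductorNorm ℤ) K')
    (Dt' : ModularParametrizationData Wd (Wd.conductorNorm ℤ)) (hc' : Odd Dt'.c)
    (β' : ℤ) (ι' : K' →+* ℂ) (d₁' : KolyvaginHeegnerData Dt' β' ι' 1)
    (P' : (Wd.baseChange K').toAffine.Point)
    (hP' : WeierstrassCurve.Affine.Point.map (W' := Wd) (algebraMap K' (ringClassField K' ι' 1)).toRatAlgHom P' = d₁'.derivedPoint)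
    (j : K' →ₐ[ℚ] ℚ_[2])
    (hstar1 : haveI : Fact (Nat.Prime 2) := ⟨Nat.prime_two⟩;
      ‖(Wd.baseChange ℚ_[2]).padicLogPoint ((((Wd.baseChange ℚ_[2]).localTamagawaNumber ℤ_[2]) * nsPointCountAtTwo Wd) •
          WeierstrassCurve.Affine.Point.map j P') / ((((Wd.baseChange ℚ_[2]).localTamagawaNumber ℤ_[2] : ℕ) : ℚ_[2]) * (Dt'.c : ℚ_[2]))‖ = 2⁻¹ * 2⁻¹)
    (hc2 : haveI : Fact (Nat.Prime 2) := ⟨Nat.prime_two⟩; Odd ((Wd.baseChange ℚ_[2]).localTamagawaNumber ℤ_[2]))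
    (W' : WeierstrassCurve ℚ) [W'.IsElliptic] [W'.IsGloballyMinimal]
    (hW' : ∃ C : VariableChange ℚ, C • Wd.quadraticTwist (NumberField.discr K' : ℚ) = W')
    (q' : ℚ) (hq' : shaAn W' = (q' : ℂ)) (hB3 : 0 ≤ padicValRat 2 q') :
    ∃ qd : ℚ, shaAn Wd = (qd : ℂ) ∧ padicValRat 2 qd ≤ 0 :=
  K1Neg.rankOneHalf_of_depthOneFrame hGZ hL hGZK hMi W hneg K hIQ hodd hHe Wd hWd hrd hSel K' hIQ' hodd' h3' hHe' Dt' hc' β' ι' d₁' P' hP'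
    (not_exists_four_zsmul_eq_of_depthOneCertificate Wd Dt' K' P' j hstar1 hc2 hc').1 W' hW' q' hq' hB3

end Summit.BirchSwinnertonDyer.BirchSwinnertonDyer.Theorems.GenusExact.SuHalves.DepthOne

end
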